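import Summits.QuantumFields.YangMills.Theorems.CovariantDischargeDoorExponentRows
import HarnessLib

/-!
# Line «sandwich_discharge» on crux `HistoryTailL` (stmt-QuantumFields-19936), stub `stub_sandwichSweepGapCapped` (S′), B6 door leaf `hGLUE` —
# «THE GLUE LETTERS»: the comb sweep's cost bracket `REST` (✓`CovariantDischargeCombSweepProfileGlue.profile_signal_sub_cost_le_wilsonAction4_sub_sweepInv`,
# w5 g14) against five monomial budgets, and each monomial in the profile socket's letters under the severity CAP and the threshold ratio

Cell `ym3-torus` (YM ladder rung R3 = continuum SU(2) Yang–Mills on the three-torus — a RUNG, NOT the Clay problem: not d = 4, not infinite volume,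
not a mass gap); WIDTH seat `ym3-torus-px8` gen 8 (the B6 door pen); `--supports stmt-QuantumFields-19936` (helper).  THEOREMS ONLY (0 `def`, default heartbeats).

WHY (DOOR SKELETON v4 d7538d1f, leaf `hGLUE : ∃ REST, REST ≤ s·θ∕16 + B_c·L^j·s² ∧ SIG − REST ≤ A(V) − A(Ψ′V)`).  The second conjunct is w5 g14's GLUE-KNIT with
`REST = ¾s²Q + θ_K·d·(sM_L)·(2(4τ + 4η + θ_K) + 176τ) + (3∕2)·d·(sM_L)·((8τ² + 2τ(4η + θ_K))·(2(4τ + 4η + θ_K)) + 30976τ³)`, `τ := s·A_T·4L^{2j}` ((T″)),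
`M_L := (A_L + A_L′(2R + 1 + 2L^h))·4L^{2j}` ((S″)), `Q := 328·8L^j + A_Q(24L^{2j}L^h)²∕(R−2)^5` ((Q″)), `η := ((2d(r+1)+2)²∕4)·θ_K` (lasso, `r = 2R + L^h`), `d = 3`,
`s := κθ∕(2B_cL^j)`, `κ = 1∕8`, `B_c := 3(2624 + 32·576·A_Q) + 1`, `R = N_R·L^(2j+h)`, `h = j + m`, `N_R ≥ 12`.  THIS FILE (letters; the assembly
★★`glue_rest_le` and the `j₀` slot ★`exists_j0_glue` are ✍`CovariantDischargeDoorGlueRows`):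
* §2 `rest_abstract_le` — the bracket against five monomial budgets `≤ s·θ∕64` (pure algebra: `(8τ² + 2τ(4η+θ_K))·2(4τ+4η+θ_K) = 4τ(4τ+4η+θ_K)²`);
* §3 the letters under CAP `x ≤ (151L²L⁻¹⁹)^j`, ratio `θ_K ≤ 2^{p₀}(√L⁻¹)^jθ`, `θ ≤ x ≤ 1`: `eta_le` (`η ≤ 49R²θ_K`), `radius_facts`, `mass_le` (`M_L ≤ A₁·R·L^{2j}`,
  `A₁ := 4(A_L + 3A_L′)`), `Q_le` (`Q ≤ (2624 + 18432A_Q)·L^j`), `thetaK_le`, the cap monomials `radius_cube_mul_le` (`RL^{3j}θ_K`), `radius_five_mul_le` (`RL^{5j}θ²`),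
  and the five budgets `m1_le`, `m2_le`, `m4_le`, `m5_le`, `cQ_le` over free reals (cores ✓`core_R3`∕✓`core_R5` enter as hypotheses).
HONEST SCOPE: real arithmetic; NOTHING here proves the capped stub, `HistoryTailL`, or any summit statement; YM₃ on T³ is rung R3, not Clay. [folklore]
-/

noncomputable section

namespace Summit.QuantumFields.YangMills.Theorems.CovariantDischargeDoorGlueLetters

open Summit.QuantumFields.YangMills.Theorems.CovariantDischargeDoorExponentRows

/-! ## §2 The cost bracket against five monomial budgets -/

/-- **THE BRACKET, ABSTRACTLY**: with `μ := s·M_L`, if `¾s²Q`, `552θ_Kμτ`, `24μθ_Kη + 6μθ_K² + 54μτθ_K²`, `140256μτ³`, `864μτη²` are each `≤ sθ∕64` and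
`sθ∕16 = B_cL^js²`, then `REST ≤ sθ∕16 + B_cL^js²` (`d = 3`). [folklore] -/
theorem rest_abstract_le {s θ θK τ η μ Q Bc Λ : ℝ} (hs : 0 ≤ s) (hθ : 0 ≤ θ) (hτ : 0 ≤ τ) (hμ : 0 ≤ μ)
    (hC : 3 / 4 * s ^ 2 * Q ≤ s * θ / 64) (hm1 : 552 * θK * μ * τ ≤ s * θ / 64)
    (hm2 : 24 * μ * θK * η + 6 * μ * θK ^ 2 + 54 * μ * τ * θK ^ 2 ≤ s * θ / 64)
    (hm4 : 140256 * μ * τ ^ 3 ≤ s * θ / 64) (hm5 : 864 * μ * τ * η ^ 2 ≤ s * θ / 64) (hbud : s * θ / 16 = Bc * Λ * s ^ 2) :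
    3 / 4 * s ^ 2 * Q + θK * ((3 : ℕ) : ℝ) * μ * (2 * (4 * τ + 4 * η + θK) + 176 * τ) +
      3 / 2 * ((3 : ℕ) : ℝ) * μ * ((8 * τ ^ 2 + 2 * τ * (4 * η + θK)) * (2 * (4 * τ + 4 * η + θK)) + 30976 * τ ^ 3)
      ≤ s * θ / 16 + Bc * Λ * s ^ 2 := by
  have hsq : (4 * τ + 4 * η + θK) ^ 2 ≤ 3 * (16 * τ ^ 2 + 16 * η ^ 2 + θK ^ 2) := by
    nlinarith [sq_nonneg (4 * τ - 4 * η), sq_nonneg (4 * τ - θK), sq_nonneg (4 * η - θK)]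
  have hid : (8 * τ ^ 2 + 2 * τ * (4 * η + θK)) * (2 * (4 * τ + 4 * η + θK)) = 4 * τ * (4 * τ + 4 * η + θK) ^ 2 := by ring
  have hB : 3 / 2 * ((3 : ℕ) : ℝ) * μ * ((8 * τ ^ 2 + 2 * τ * (4 * η + θK)) * (2 * (4 * τ + 4 * η + θK)) + 30976 * τ ^ 3)
      ≤ 140256 * μ * τ ^ 3 + 864 * μ * τ * η ^ 2 + 54 * μ * τ * θK ^ 2 := by
    rw [hid]
    have h1 : 4 * τ * (4 * τ + 4 * η + θK) ^ 2 ≤ 4 * τ * (3 * (16 * τ ^ 2 + 16 * η ^ 2 + θK ^ 2)) :=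
      mul_le_mul_of_nonneg_left hsq (by positivity)
    have h2 : 3 / 2 * ((3 : ℕ) : ℝ) * μ * (4 * τ * (4 * τ + 4 * η + θK) ^ 2 + 30976 * τ ^ 3) ≤
        3 / 2 * ((3 : ℕ) : ℝ) * μ * (4 * τ * (3 * (16 * τ ^ 2 + 16 * η ^ 2 + θK ^ 2)) + 30976 * τ ^ 3) := by
      push_cast
      exact mul_le_mul_of_nonneg_left (by linarith) (by positivity)
    refine h2.trans (le_of_eq ?_)
    push_cast
    ring
  have hA : θK * ((3 : ℕ) : ℝ) * μ * (2 * (4 * τ + 4 * η + θK) + 176 * τ) =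
      552 * θK * μ * τ + 24 * μ * θK * η + 6 * μ * θK ^ 2 := by
    push_cast; ring
  have hsθ : 0 ≤ s * θ := mul_nonneg hs hθ
  rw [hA, ← hbud]
  linarith

/-! ## §3 The monomial bounds in the socket's letters -/

section Letters

variable {L j m h r R N_R : ℕ} {θ θK x p₀ A_Q A_L A_L' A_T Bc s : ℝ}

/-- The lasso constant on the pairing box: `((2·3·(r+1)+2)²∕4)·θ_K ≤ 49R²·θ_K` for `r = 2R + L^h`, `4L^h + 4 ≤ R`. [folklore] -/
theorem eta_le (hr : r = 2 * R + L ^ h) (hRh : 4 * L ^ h + 4 ≤ R) (hθK0 : 0 ≤ θK) :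
    (((2 * (3 : ℕ) * (r + 1) + 2 : ℕ) : ℝ) ^ 2 / 4) * θK ≤ 49 * (R : ℝ) ^ 2 * θK := by
  refine mul_le_mul_of_nonneg_right ?_ hθK0
  have h1 : ((2 * (3 : ℕ) * (r + 1) + 2 : ℕ) : ℝ) = 2 * (6 * (R : ℝ) + 3 * ((L ^ h : ℕ) : ℝ) + 4) := by
    rw [hr]; push_cast; ring
  have h2 : 3 * ((L ^ h : ℕ) : ℝ) + 4 ≤ (R : ℝ) := by exact_mod_cast (show 3 * L ^ h + 4 ≤ R by omega)
  have h3 : (0 : ℝ) ≤ 3 * ((L ^ h : ℕ) : ℝ) + 4 := by positivity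
  rw [h1]
  have h4 : (2 * (6 * (R : ℝ) + 3 * ((L ^ h : ℕ) : ℝ) + 4)) ^ 2 ≤ (2 * (7 * (R : ℝ))) ^ 2 := by
    apply pow_le_pow_left₀ (by positivity)
    linarith
  calc (2 * (6 * (R : ℝ) + 3 * ((L ^ h : ℕ) : ℝ) + 4)) ^ 2 / 4 ≤ (2 * (7 * (R : ℝ))) ^ 2 / 4 := by gcongr
    _ = 49 * (R : ℝ) ^ 2 := by ring

/-- Radius facts for `R = N_R·L^(2j+h)`, `N_R ≥ 12`, `L ≥ 1`: `12 ≤ R`, `4L^h + 4 ≤ R`, `L^j ≤ R` (in `ℕ`). [folklore] -/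
theorem radius_facts (hL : 1 ≤ L) (hR : R = N_R * L ^ (2 * j + h)) (hNR : 12 ≤ N_R) :
    12 ≤ R ∧ 4 * L ^ h + 4 ≤ R ∧ L ^ j ≤ R := by
  have hLh : 1 ≤ L ^ h := Nat.one_le_pow _ _ hL
  have hLp : L ^ h ≤ L ^ (2 * j + h) := Nat.pow_le_pow_right hL (by omega)
  have hLj : L ^ j ≤ L ^ (2 * j + h) := Nat.pow_le_pow_right hL (by omega)
  have h12 : 12 * L ^ (2 * j + h) ≤ R := by rw [hR]; exact Nat.mul_le_mul_right _ hNR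
  refine ⟨?_, ?_, ?_⟩ <;> nlinarith

/-- The ℓ¹ mass against the radius: `(A_L + A_L′(2R+1+2L^h))·4L^{2j} ≤ (4(A_L + 3A_L′))·R·(L^j)²` (`1 ≤ R`, `2L^h + 1 ≤ R`). [folklore] -/
theorem mass_le (hL : 1 ≤ L) (hR : R = N_R * L ^ (2 * j + h)) (hNR : 12 ≤ N_R) (hAL : 0 ≤ A_L) (hAL' : 0 ≤ A_L') :
    (A_L + A_L' * (2 * (R : ℝ) + 1 + 2 * (L : ℝ) ^ h)) * (4 * ((L : ℝ) ^ j) ^ 2) ≤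
      (4 * (A_L + 3 * A_L')) * (R : ℝ) * ((L : ℝ) ^ j) ^ 2 := by
  obtain ⟨hR12, hRh, -⟩ := radius_facts hL hR hNR
  have hR1 : (1 : ℝ) ≤ R := by exact_mod_cast (show 1 ≤ R by omega)
  have hRh' : 2 * (L : ℝ) ^ h + 1 ≤ R := by exact_mod_cast (show 2 * L ^ h + 1 ≤ R by omega)
  have h1 : A_L + A_L' * (2 * (R : ℝ) + 1 + 2 * (L : ℝ) ^ h) ≤ (A_L + 3 * A_L') * R := by nlinarith
  have hΛ : (0 : ℝ) ≤ ((L : ℝ) ^ j) ^ 2 := by positivity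
  nlinarith

/-- The curl-square mass against the block: `328·8L^j + A_Q(24L^{2j}L^h)²∕(R−2)^5 ≤ (2624 + 18432A_Q)·L^j` (`R = N_R L^(2j+h)`, `N_R ≥ 12`). [folklore] -/
theorem Q_le (hL : 1 ≤ L) (hR : R = N_R * L ^ (2 * j + h)) (hNR : 12 ≤ N_R) (hAQ : 0 ≤ A_Q) :
    328 * (8 * (L : ℝ) ^ j) + A_Q * (24 * ((L : ℝ) ^ j) ^ 2 * (L : ℝ) ^ h) ^ 2 / ((R : ℝ) - 2) ^ 5 ≤
      (2624 + 18432 * A_Q) * (L : ℝ) ^ j := by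
  obtain ⟨hR12, -, -⟩ := radius_facts hL hR hNR
  have hL1 : (1 : ℝ) ≤ L := by exact_mod_cast hL
  have hR12' : (12 : ℝ) ≤ R := by exact_mod_cast hR12
  have hR2 : (0 : ℝ) < (R : ℝ) - 2 := by linarith
  have hΛ1 : (1 : ℝ) ≤ (L : ℝ) ^ j := one_le_pow₀ hL1
  -- `(R−2)^5 ≥ (R∕2)^5`, `R^5 ≤ 32(R−2)^5`
  have hhalf : (R : ℝ) / 2 ≤ (R : ℝ) - 2 := by linarith
  have hpow : ((R : ℝ) / 2) ^ 5 ≤ ((R : ℝ) - 2) ^ 5 := pow_le_pow_left₀ (by positivity) hhalf 5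
  have hR5 : (R : ℝ) ^ 5 ≤ 32 * ((R : ℝ) - 2) ^ 5 := by
    have e : ((R : ℝ) / 2) ^ 5 = (R : ℝ) ^ 5 / 32 := by ring
    rw [e] at hpow
    linarith
  -- `L^(3j) L^(2h) ≤ (L^(2j+h))^3 ≤ R^3 ≤ R^5`
  have hRpow : (R : ℝ) = N_R * (L : ℝ) ^ (2 * j + h) := by rw [hR]; push_cast; ring
  have hNR' : (12 : ℝ) ≤ N_R := by exact_mod_cast hNR
  have hLR : (L : ℝ) ^ (2 * j + h) ≤ R := by
    rw [hRpow]
    have : (0 : ℝ) ≤ (L : ℝ) ^ (2 * j + h) := by positivity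
    nlinarith
  have hR1 : (1 : ℝ) ≤ R := by linarith
  have hkey : ((L : ℝ) ^ j) ^ 3 * ((L : ℝ) ^ h) ^ 2 ≤ (R : ℝ) ^ 5 := by
    have e1 : ((L : ℝ) ^ j) ^ 3 * ((L : ℝ) ^ h) ^ 2 = (L : ℝ) ^ (3 * j + 2 * h) := by
      rw [← pow_mul, ← pow_mul, ← pow_add]; ring_nf
    have e2 : (L : ℝ) ^ (3 * j + 2 * h) ≤ (L : ℝ) ^ (3 * (2 * j + h)) := pow_le_pow_right₀ hL1 (by omega)
    have e3 : (L : ℝ) ^ (3 * (2 * j + h)) = ((L : ℝ) ^ (2 * j + h)) ^ 3 := by rw [pow_mul']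
    have e4 : ((L : ℝ) ^ (2 * j + h)) ^ 3 ≤ (R : ℝ) ^ 3 := pow_le_pow_left₀ (by positivity) hLR 3
    have e5 : (R : ℝ) ^ 3 ≤ (R : ℝ) ^ 5 := pow_le_pow_right₀ hR1 (by norm_num)
    rw [e1]
    linarith [e2, e3.le, e3.ge, e4, e5]
  -- the `A_Q` term
  have hAQterm : A_Q * (24 * ((L : ℝ) ^ j) ^ 2 * (L : ℝ) ^ h) ^ 2 / ((R : ℝ) - 2) ^ 5 ≤ 18432 * A_Q * (L : ℝ) ^ j := by
    rw [div_le_iff₀ (pow_pos hR2 5)]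
    have e : A_Q * (24 * ((L : ℝ) ^ j) ^ 2 * (L : ℝ) ^ h) ^ 2 = 576 * A_Q * (L : ℝ) ^ j * (((L : ℝ) ^ j) ^ 3 * ((L : ℝ) ^ h) ^ 2) := by
      ring
    rw [e]
    have hpos : (0 : ℝ) ≤ 576 * A_Q * (L : ℝ) ^ j := by positivity
    calc 576 * A_Q * (L : ℝ) ^ j * (((L : ℝ) ^ j) ^ 3 * ((L : ℝ) ^ h) ^ 2)
        ≤ 576 * A_Q * (L : ℝ) ^ j * ((R : ℝ) ^ 5) := mul_le_mul_of_nonneg_left hkey hpos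
      _ ≤ 576 * A_Q * (L : ℝ) ^ j * (32 * ((R : ℝ) - 2) ^ 5) := mul_le_mul_of_nonneg_left hR5 hpos
      _ = 18432 * A_Q * (L : ℝ) ^ j * ((R : ℝ) - 2) ^ 5 := by ring
  linarith

/-- `θ_K ≤ 2^{p₀}·θ` from the ratio letter (`(√L⁻¹)^j ≤ 1`). [folklore] -/
theorem thetaK_le (hL : 1 ≤ L) (hθ : 0 ≤ θ) (hθK : θK ≤ (2 : ℝ) ^ p₀ * Real.sqrt ((L : ℝ)⁻¹) ^ j * θ) :
    θK ≤ (2 : ℝ) ^ p₀ * θ := by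
  have hL1 : (1 : ℝ) ≤ L := by exact_mod_cast hL
  have hs1 : Real.sqrt ((L : ℝ)⁻¹) ^ j ≤ 1 :=
    pow_le_one₀ (Real.sqrt_nonneg _) (Real.sqrt_le_one.mpr (inv_le_one_of_one_le₀ hL1))
  have h2 : (0 : ℝ) ≤ (2 : ℝ) ^ p₀ := by positivity
  calc θK ≤ (2 : ℝ) ^ p₀ * Real.sqrt ((L : ℝ)⁻¹) ^ j * θ := hθK
    _ ≤ (2 : ℝ) ^ p₀ * 1 * θ := by gcongr
    _ = (2 : ℝ) ^ p₀ * θ := by ring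

/-- **CAP MONOMIAL `R·L^{3j}·θ_K ≤ N_R·2^{p₀}·L^m·151^j∕L^{11j}`** (`θ_K ≤ 2^{p₀}θ`, `θ ≤ x ≤ 151^j∕L^{17j}`, `R = N_R L^{3j+m}`). [folklore] -/
theorem radius_cube_mul_le (hL : 1 ≤ L) (hh : h = j + m) (hR : R = N_R * L ^ (2 * j + h)) (hθ : 0 ≤ θ) (hθx : θ ≤ x)
    (hx : x ≤ (151 * (L : ℝ) ^ 2 * ((L : ℝ)⁻¹) ^ 19) ^ j)
    (hθK : θK ≤ (2 : ℝ) ^ p₀ * Real.sqrt ((L : ℝ)⁻¹) ^ j * θ) :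
    (R : ℝ) * ((L : ℝ) ^ j) ^ 3 * θK ≤ (N_R : ℝ) * (2 : ℝ) ^ p₀ * (L : ℝ) ^ m * (151 : ℝ) ^ j / (L : ℝ) ^ (11 * j) := by
  have hL1 : (1 : ℝ) ≤ L := by exact_mod_cast hL
  have hL0 : (0 : ℝ) < L := by linarith
  rw [cap_pow_eq hL] at hx
  have hθK' : θK ≤ (2 : ℝ) ^ p₀ * ((151 : ℝ) ^ j / (L : ℝ) ^ (17 * j)) :=
    (thetaK_le hL hθ hθK).trans (mul_le_mul_of_nonneg_left (hθx.trans hx) (by positivity))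
  have hRpow : (R : ℝ) * ((L : ℝ) ^ j) ^ 3 = N_R * (L : ℝ) ^ m * (L : ℝ) ^ (6 * j) := by
    rw [hR, hh]; push_cast; ring
  rw [hRpow]
  have hpos : (0 : ℝ) ≤ N_R * (L : ℝ) ^ m * (L : ℝ) ^ (6 * j) := by positivity
  calc (N_R : ℝ) * (L : ℝ) ^ m * (L : ℝ) ^ (6 * j) * θK
      ≤ N_R * (L : ℝ) ^ m * (L : ℝ) ^ (6 * j) * ((2 : ℝ) ^ p₀ * ((151 : ℝ) ^ j / (L : ℝ) ^ (17 * j))) :=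
        mul_le_mul_of_nonneg_left hθK' hpos
    _ = (N_R : ℝ) * (2 : ℝ) ^ p₀ * (L : ℝ) ^ m * (151 : ℝ) ^ j / (L : ℝ) ^ (11 * j) := by
        have key : (L : ℝ) ^ (17 * j) = (L : ℝ) ^ (6 * j) * (L : ℝ) ^ (11 * j) := by rw [← pow_add]; ring_nf
        rw [key]
        field_simp

/-- **CAP MONOMIAL `R·L^{5j}·θ² ≤ N_R·L^m·22801^j∕L^{26j}`** (`θ ≤ x ≤ 151^j∕L^{17j}`, `R = N_R L^{3j+m}`). [folklore] -/
theorem radius_five_mul_le (hL : 1 ≤ L) (hh : h = j + m) (hR : R = N_R * L ^ (2 * j + h)) (hθ : 0 ≤ θ) (hθx : θ ≤ x)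
    (hx : x ≤ (151 * (L : ℝ) ^ 2 * ((L : ℝ)⁻¹) ^ 19) ^ j) :
    (R : ℝ) * ((L : ℝ) ^ j) ^ 5 * θ ^ 2 ≤ (N_R : ℝ) * (L : ℝ) ^ m * (22801 : ℝ) ^ j / (L : ℝ) ^ (26 * j) := by
  have hL1 : (1 : ℝ) ≤ L := by exact_mod_cast hL
  have hL0 : (0 : ℝ) < L := by linarith
  rw [cap_pow_eq hL] at hx
  have hθ2 : θ ^ 2 ≤ ((151 : ℝ) ^ j / (L : ℝ) ^ (17 * j)) ^ 2 := pow_le_pow_left₀ hθ (hθx.trans hx) 2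
  have hRpow : (R : ℝ) * ((L : ℝ) ^ j) ^ 5 = N_R * (L : ℝ) ^ m * (L : ℝ) ^ (8 * j) := by
    rw [hR, hh]; push_cast; ring
  rw [hRpow]
  have hpos : (0 : ℝ) ≤ N_R * (L : ℝ) ^ m * (L : ℝ) ^ (8 * j) := by positivity
  calc (N_R : ℝ) * (L : ℝ) ^ m * (L : ℝ) ^ (8 * j) * θ ^ 2
      ≤ N_R * (L : ℝ) ^ m * (L : ℝ) ^ (8 * j) * (((151 : ℝ) ^ j / (L : ℝ) ^ (17 * j)) ^ 2) :=
        mul_le_mul_of_nonneg_left hθ2 hpos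
    _ = (N_R : ℝ) * (L : ℝ) ^ m * (22801 : ℝ) ^ j / (L : ℝ) ^ (26 * j) := by
        have key : (22801 : ℝ) ^ j = (151 : ℝ) ^ j * (151 : ℝ) ^ j := by rw [← mul_pow]; norm_num
        have key2 : (L : ℝ) ^ (17 * j) * (L : ℝ) ^ (17 * j) = (L : ℝ) ^ (8 * j) * (L : ℝ) ^ (26 * j) := by
          rw [← pow_add, ← pow_add]; ring_nf
        rw [key, div_pow, sq, sq, key2]
        field_simp

/-! ### The five budgets, abstractly (letters as free reals) -/

/-- (m1) `552θ_K·M_L·τ ≤ θ∕64` from `M_L ≤ A₁RΛ²`, `τ ≤ θA_TΛ∕4`, the cap monomial `RΛ³θ_K ≤ G` and the row `8832A_TA₁G ≤ 1`. [folklore] -/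
theorem m1_le {θ θK τ ML A₁ A_T R Λ G : ℝ} (hθ : 0 ≤ θ) (hθK : 0 ≤ θK) (hτ0 : 0 ≤ τ) (hA₁ : 0 ≤ A₁) (hAT : 0 ≤ A_T)
    (hR : 0 ≤ R) (hMLle : ML ≤ A₁ * R * Λ ^ 2) (hτle : τ ≤ θ * A_T * Λ / 4)
    (hG : R * Λ ^ 3 * θK ≤ G) (hrow : 8832 * A_T * A₁ * G ≤ 1) : 552 * θK * ML * τ ≤ θ / 64 := by
  have hc : 0 ≤ 138 * A_T * A₁ * θ := by positivity
  calc 552 * θK * ML * τ ≤ 552 * θK * (A₁ * R * Λ ^ 2) * (θ * A_T * Λ / 4) := by gcongr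
    _ = 138 * A_T * A₁ * θ * (R * Λ ^ 3 * θK) := by ring
    _ ≤ 138 * A_T * A₁ * θ * G := mul_le_mul_of_nonneg_left hG hc
    _ = θ / 64 * (8832 * A_T * A₁ * G) := by ring
    _ ≤ θ / 64 * 1 := mul_le_mul_of_nonneg_left hrow (by positivity)
    _ = θ / 64 := mul_one _

/-- (m2) `24M_Lθ_Kη + 6M_Lθ_K² + 54M_Lτθ_K² ≤ θ∕64` from the core `R³Λ²θ_K² ≤ N·θ` and the row `(75648 + 864A_T)A₁N ≤ 1`
(`η ≤ 49R²θ_K`, `θ ≤ 1`, `1 ≤ R`, `Λ ≤ R`). [folklore] -/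
theorem m2_le {θ θK τ η ML A₁ A_T R Λ N : ℝ} (hθ : 0 ≤ θ) (hθ1 : θ ≤ 1) (hθK : 0 ≤ θK) (hτ0 : 0 ≤ τ) (hη0 : 0 ≤ η)
    (hA₁ : 0 ≤ A₁) (hAT : 0 ≤ A_T) (hR1 : 1 ≤ R) (hΛ : 0 ≤ Λ) (hΛR : Λ ≤ R)
    (hMLle : ML ≤ A₁ * R * Λ ^ 2) (hτle : τ ≤ θ * A_T * Λ / 4) (hηle : η ≤ 49 * R ^ 2 * θK)
    (hC3 : R ^ 3 * Λ ^ 2 * θK ^ 2 ≤ N * θ) (hrow : (75648 + 864 * A_T) * A₁ * N ≤ 1) :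
    24 * ML * θK * η + 6 * ML * θK ^ 2 + 54 * ML * τ * θK ^ 2 ≤ θ / 64 := by
  have hR : 0 ≤ R := by linarith
  have hRR3 : R ≤ R ^ 3 := by nlinarith
  have k1 : 24 * ML * θK * η ≤ 1176 * A₁ * (R ^ 3 * Λ ^ 2 * θK ^ 2) := by
    calc 24 * ML * θK * η ≤ 24 * (A₁ * R * Λ ^ 2) * θK * (49 * R ^ 2 * θK) := by gcongr
      _ = 1176 * A₁ * (R ^ 3 * Λ ^ 2 * θK ^ 2) := by ring
  have k2 : 6 * ML * θK ^ 2 ≤ 6 * A₁ * (R ^ 3 * Λ ^ 2 * θK ^ 2) := by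
    calc 6 * ML * θK ^ 2 ≤ 6 * (A₁ * R * Λ ^ 2) * θK ^ 2 := by gcongr
      _ ≤ 6 * (A₁ * R ^ 3 * Λ ^ 2) * θK ^ 2 := by gcongr
      _ = 6 * A₁ * (R ^ 3 * Λ ^ 2 * θK ^ 2) := by ring
  have k3 : 54 * ML * τ * θK ^ 2 ≤ 27 / 2 * A_T * A₁ * (R ^ 3 * Λ ^ 2 * θK ^ 2) := by
    have hΛR2 : Λ ≤ R ^ 2 := hΛR.trans (by nlinarith)
    have hΛ3 : Λ ^ 3 ≤ R ^ 2 * Λ ^ 2 := by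
      rw [pow_succ']; exact mul_le_mul_of_nonneg_right hΛR2 (sq_nonneg Λ)
    calc 54 * ML * τ * θK ^ 2 ≤ 54 * (A₁ * R * Λ ^ 2) * (θ * A_T * Λ / 4) * θK ^ 2 := by gcongr
      _ ≤ 54 * (A₁ * R * Λ ^ 2) * (1 * A_T * Λ / 4) * θK ^ 2 := by gcongr
      _ = 27 / 2 * A_T * A₁ * (R * Λ ^ 3 * θK ^ 2) := by ring
      _ ≤ 27 / 2 * A_T * A₁ * (R * (R ^ 2 * Λ ^ 2) * θK ^ 2) := by gcongr
      _ = 27 / 2 * A_T * A₁ * (R ^ 3 * Λ ^ 2 * θK ^ 2) := by ring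
  have hsum : 24 * ML * θK * η + 6 * ML * θK ^ 2 + 54 * ML * τ * θK ^ 2 ≤
      (1182 + 27 / 2 * A_T) * A₁ * (R ^ 3 * Λ ^ 2 * θK ^ 2) := by linarith
  refine hsum.trans ?_
  have hc : 0 ≤ (1182 + 27 / 2 * A_T) * A₁ := by positivity
  calc (1182 + 27 / 2 * A_T) * A₁ * (R ^ 3 * Λ ^ 2 * θK ^ 2) ≤ (1182 + 27 / 2 * A_T) * A₁ * (N * θ) :=
        mul_le_mul_of_nonneg_left hC3 hc
    _ = θ / 64 * ((75648 + 864 * A_T) * A₁ * N) := by ring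
    _ ≤ θ / 64 * 1 := mul_le_mul_of_nonneg_left hrow (by positivity)
    _ = θ / 64 := mul_one _

/-- (m4) `140256·M_L·τ³ ≤ θ∕64` from the cap monomial `RΛ⁵θ² ≤ G` and the row `140256A₁A_T³G ≤ 1`. [folklore] -/
theorem m4_le {θ τ ML A₁ A_T R Λ G : ℝ} (hθ : 0 ≤ θ) (hτ0 : 0 ≤ τ) (hA₁ : 0 ≤ A₁) (hAT : 0 ≤ A_T) (hR : 0 ≤ R)
    (hMLle : ML ≤ A₁ * R * Λ ^ 2) (hτle : τ ≤ θ * A_T * Λ / 4) (hG : R * Λ ^ 5 * θ ^ 2 ≤ G)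
    (hrow : 140256 * A₁ * A_T ^ 3 * G ≤ 1) : 140256 * ML * τ ^ 3 ≤ θ / 64 := by
  have hτ3 : τ ^ 3 ≤ (θ * A_T * Λ / 4) ^ 3 := pow_le_pow_left₀ hτ0 hτle 3
  have hc : 0 ≤ 140256 / 64 * A₁ * A_T ^ 3 * θ := by positivity
  calc 140256 * ML * τ ^ 3 ≤ 140256 * (A₁ * R * Λ ^ 2) * (θ * A_T * Λ / 4) ^ 3 := by gcongr
    _ = 140256 / 64 * A₁ * A_T ^ 3 * θ * (R * Λ ^ 5 * θ ^ 2) := by ring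
    _ ≤ 140256 / 64 * A₁ * A_T ^ 3 * θ * G := mul_le_mul_of_nonneg_left hG hc
    _ = θ / 64 * (140256 * A₁ * A_T ^ 3 * G) := by ring
    _ ≤ θ / 64 * 1 := mul_le_mul_of_nonneg_left hrow (by positivity)
    _ = θ / 64 := mul_one _

/-- (m5) `864·M_L·τ·η² ≤ θ∕64` from the core `R⁵Λ³θ_K² ≤ N` and the row `33191424A₁A_TN ≤ 1` (`η ≤ 49R²θ_K`). [folklore] -/
theorem m5_le {θ θK τ η ML A₁ A_T R Λ N : ℝ} (hθ : 0 ≤ θ) (hτ0 : 0 ≤ τ) (hη0 : 0 ≤ η) (hA₁ : 0 ≤ A₁)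
    (hAT : 0 ≤ A_T) (hR : 0 ≤ R) (hΛ : 0 ≤ Λ) (hMLle : ML ≤ A₁ * R * Λ ^ 2)
    (hτle : τ ≤ θ * A_T * Λ / 4) (hηle : η ≤ 49 * R ^ 2 * θK) (hC5 : R ^ 5 * Λ ^ 3 * θK ^ 2 ≤ N)
    (hrow : 33191424 * A₁ * A_T * N ≤ 1) : 864 * ML * τ * η ^ 2 ≤ θ / 64 := by
  have hη2 : η ^ 2 ≤ (49 * R ^ 2 * θK) ^ 2 := pow_le_pow_left₀ hη0 hηle 2
  have hc : 0 ≤ 518616 * A₁ * A_T * θ := by positivity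
  calc 864 * ML * τ * η ^ 2 ≤ 864 * (A₁ * R * Λ ^ 2) * (θ * A_T * Λ / 4) * (49 * R ^ 2 * θK) ^ 2 := by gcongr
    _ = 518616 * A₁ * A_T * θ * (R ^ 5 * Λ ^ 3 * θK ^ 2) := by ring
    _ ≤ 518616 * A₁ * A_T * θ * N := mul_le_mul_of_nonneg_left hC5 hc
    _ = θ / 64 * (33191424 * A₁ * A_T * N) := by ring
    _ ≤ θ / 64 * 1 := mul_le_mul_of_nonneg_left hrow (by positivity)
    _ = θ / 64 := mul_one _

/-- (C) `¾s²Q ≤ sθ∕64` from `Q ≤ B_QΛ`, `B_Q ≤ B_c∕3` and the budget identity `sθ∕16 = B_cΛs²`. [folklore] -/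
theorem cQ_le {s θ Q B_Q Bc Λ : ℝ} (hΛ : 0 ≤ Λ) (hQ : Q ≤ B_Q * Λ) (hBQ : B_Q ≤ Bc / 3)
    (hbud : s * θ / 16 = Bc * Λ * s ^ 2) : 3 / 4 * s ^ 2 * Q ≤ s * θ / 64 := by
  have hs2 : (0 : ℝ) ≤ 3 / 4 * s ^ 2 := by positivity
  have e : B_Q * Λ ≤ Bc / 3 * Λ := mul_le_mul_of_nonneg_right hBQ hΛ
  calc 3 / 4 * s ^ 2 * Q ≤ 3 / 4 * s ^ 2 * (B_Q * Λ) := mul_le_mul_of_nonneg_left hQ hs2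
    _ ≤ 3 / 4 * s ^ 2 * (Bc / 3 * Λ) := mul_le_mul_of_nonneg_left e hs2
    _ = (Bc * Λ * s ^ 2) / 4 := by ring
    _ = s * θ / 64 := by rw [← hbud]; ring

end Letters

end Summit.QuantumFields.YangMills.Theorems.CovariantDischargeDoorGlueLetters

end
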